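import Mathlib.Algebra.MvPolynomial.PDeriv
import Mathlib.Analysis.Complex.Basic
import Mathlib.Tactic
import Literature.Combinatorics.StablePolynomials.Basic
import Summits.CriticalPhenomena.PercolationContinuityZ3.Theorems.PercNearOneGluingNoHeavyLowerTailYHeadLevelStable
import HarnessLib

/-!
# The Y-site family of the site model is a homogeneous strongly Rayleigh coefficient family

Support file for the Sahi / Conjecture-P programme of route `PercNearOneGluingNoHeavy`
(`--supports stmt-CriticalPhenomena-4575`, prover prim-l12-p5 gen 31; proof note
`prim-l12-p5/MULTITYPE-PROOF-g31.md` §3).  No definitions, no named facts, no sorries.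

SITE MODEL of THEOREM MT: sites `s ∈ S` carry a state `κ(s) ∈ {0, 1, 2}` (`0` = empty, `1` = `X`,
`2` = `Y`) with weights `1, P_s, Q_s ≥ 0`; a configuration `κ : S → Fin 3` has weight
`w(κ) = ∏_s w_s(κ s)`.  For prescribed numbers `A` of `X`-sites and `b` of empty sites, the
**Y-site family** is `ν(Y₀) = Σ { w(κ) : κ⁻¹(2) = Y₀, #κ⁻¹(1) = A, #κ⁻¹(0) = b }`
(`= [|Y₀| = |S|−A−b] · Q^{Y₀} · e_A(P | S ∖ Y₀)`).  We identify the polynomial of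
`…LowerTailYHeadLevelStable.yHeadLevel_zero_or_stable`,
`(∂_y^b ∂_u^A ∏_s (y + P_s u + Q_s t_s))|_{u=y=0}`, with `A!·b!·Σ_{Y₀} ν(Y₀) t^{Y₀}`
(`siteLevel_identity`) and conclude that `ν` is "stable or zero" in the coefficient form of
`Literature.Combinatorics.StablePolynomials.NegativeCorrelation` (`siteLevel_stableOrZero`, and
`siteLevel_stableOrZero_XY` with the constraint `#κ⁻¹(2) = C` instead of `#κ⁻¹(0) = b`).  This is
Lemma SR of THEOREM MT in the exact form consumed by the Feder–Mihail inequality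
(`…LowerTailFederMihail`) in `…LowerTailSiteCovariance`.

Variables of the polynomial ring: `Option (Option S)` with `none = y`, `some none = u`,
`some (some s) = t_s` (as in `…YHeadLevelStable`).

* `iterate_pderiv_monomial`, `bind₁_update_zero_monomial`, `extract_monomial` : the operator
  `(·)|_{u=y=0} ∘ ∂_y^b ∘ ∂_u^A` on monomials;
* `siteProduct_eq_sum_monomial` : `∏_s (y + P_s u + Q_s t_s) = Σ_κ monomial(d κ)(w κ)`;
* `siteLevel_identity`, `siteLevel_stableOrZero`, `siteLevel_stableOrZero_XY`.
-/

namespace Summit.CriticalPhenomena.PercolationContinuityZ3.Theorems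

namespace SiteLevelFamily

open MvPolynomial Finset Literature.Combinatorics.StablePolynomials

variable {S : Type*} [Fintype S] [DecidableEq S]

/-! ### The extraction operator on monomials -/

/-- Iterated partial derivative of a monomial:
`∂_i^n (c·z^d) = c·(d_i)_n · z^{d − n e_i}` (`(d_i)_n` the falling factorial). -/
theorem iterate_pderiv_monomial {σ : Type*} (i : σ) (n : ℕ) (d : σ →₀ ℕ) (c : ℂ) :
    (pderiv i)^[n] (monomial d c) =
      monomial (d - Finsupp.single i n) (c * (Nat.descFactorial (d i) n : ℂ)) := by
  induction n with
  | zero => simp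
  | succ n ih =>
    rw [Function.iterate_succ_apply', ih, pderiv_monomial]
    congr 1
    · rw [tsub_tsub, ← Finsupp.single_add]
    · rw [Finsupp.tsub_apply, Finsupp.single_eq_same, Nat.descFactorial_succ]
      push_cast
      ring

/-- Setting `z_i := 0` in a monomial keeps it iff `z_i` does not occur. -/
theorem bind₁_update_zero_monomial {σ : Type*} [DecidableEq σ] (i : σ) (d : σ →₀ ℕ) (c : ℂ) :
    bind₁ (Function.update X i (C (0:ℂ))) (monomial d c) =
      if d i = 0 then monomial d c else 0 := by
  rw [bind₁_monomial]
  by_cases h : d i = 0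
  · rw [if_pos h, monomial_eq, Finsupp.prod]
    congr 1
    refine Finset.prod_congr rfl fun j hj => ?_
    have hji : j ≠ i := by
      rintro rfl; exact (Finsupp.mem_support_iff.1 hj) h
    rw [Function.update_of_ne hji]
  · rw [if_neg h]
    have hi : i ∈ d.support := Finsupp.mem_support_iff.2 h
    rw [Finset.prod_eq_zero hi (by rw [Function.update_self, ← map_pow, zero_pow h, map_zero]),
      mul_zero]

/-- **The extraction operator on a monomial**: for `u ≠ y`,
`[(∂_y^b ∂_u^A (c z^d))|_{u=0}]|_{y=0} = [d_u = A][d_y = b] · A!·b!·c · z^{d − A e_u − b e_y}`. -/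
theorem extract_monomial {σ : Type*} [DecidableEq σ] (u y : σ) (huy : u ≠ y) (A b : ℕ)
    (d : σ →₀ ℕ) (c : ℂ) :
    bind₁ (Function.update X y (C (0:ℂ))) (bind₁ (Function.update X u (C (0:ℂ)))
        ((pderiv y)^[b] ((pderiv u)^[A] (monomial d c)))) =
      if d u = A ∧ d y = b then
        monomial (d - Finsupp.single u A - Finsupp.single y b) (c * (A.factorial : ℂ) * (b.factorial : ℂ))
      else 0 := by
  rw [iterate_pderiv_monomial, iterate_pderiv_monomial, bind₁_update_zero_monomial]
  have hyu : (d - Finsupp.single u A) y = d y := by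
    rw [Finsupp.tsub_apply, Finsupp.single_eq_of_ne huy.symm, tsub_zero]
  have hu' : (d - Finsupp.single u A - Finsupp.single y b) u = d u - A := by
    rw [Finsupp.tsub_apply, Finsupp.tsub_apply, Finsupp.single_eq_same,
      Finsupp.single_eq_of_ne huy, tsub_zero]
  have hy' : (d - Finsupp.single u A - Finsupp.single y b) y = d y - b := by
    rw [Finsupp.tsub_apply, hyu, Finsupp.single_eq_same]
  rw [hyu, hu']
  rcases Nat.lt_trichotomy (d u) A with hlt | heq | hgt
  · -- d u < A : falling factorial vanishes
    have h0 : Nat.descFactorial (d u) A = 0 := Nat.descFactorial_eq_zero_iff_lt.2 hlt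
    rw [h0, if_neg (fun h : d u = A ∧ d y = b => absurd h.1 (ne_of_lt hlt))]
    simp
  · subst heq
    rw [Nat.sub_self, if_pos rfl, bind₁_update_zero_monomial, hy', Nat.descFactorial_self]
    rcases Nat.lt_trichotomy (d y) b with hlt' | heq' | hgt'
    · have h0 : Nat.descFactorial (d y) b = 0 := Nat.descFactorial_eq_zero_iff_lt.2 hlt'
      rw [h0, if_neg (fun h : d u = d u ∧ d y = b => absurd h.2 (ne_of_lt hlt'))]
      simp
    · subst heq'
      rw [Nat.sub_self, if_pos rfl, if_pos ⟨rfl, rfl⟩, Nat.descFactorial_self]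
    · rw [if_neg (show d y - b ≠ 0 by omega),
        if_neg (fun h : d u = d u ∧ d y = b => absurd h.2 (ne_of_gt hgt'))]
  · rw [if_neg (show d u - A ≠ 0 by omega), map_zero,
      if_neg (fun h : d u = A ∧ d y = b => absurd h.1 (ne_of_gt hgt))]

/-- Iterated partial derivatives are additive over finite sums. -/
theorem iterate_pderiv_sum {σ α : Type*} (i : σ) (n : ℕ) (T : Finset α)
    (g : α → MvPolynomial σ ℂ) :
    (pderiv i)^[n] (∑ x ∈ T, g x) = ∑ x ∈ T, (pderiv i)^[n] (g x) := by
  induction n generalizing g with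
  | zero => rfl
  | succ n ih =>
    simp only [Function.iterate_succ_apply']
    rw [ih, map_sum]

/-! ### The site product as a sum of monomials -/

omit [Fintype S] [DecidableEq S] in
/-- One site factor as a sum over its three states. -/
theorem siteFactor_eq_sum (P Q : S → ℝ) (s : S) :
    (X none + C (P s : ℂ) * X (some none) + C (Q s : ℂ) * X (some (some s)) :
        MvPolynomial (Option (Option S)) ℂ) =
      ∑ j : Fin 3, monomial
        (if j = 0 then Finsupp.single none 1 else if j = 1 then Finsupp.single (some none) 1
          else Finsupp.single (some (some s)) 1)
        (((if j = 1 then P s else if j = 2 then Q s else 1 : ℝ) : ℂ)) := by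
  rw [Fin.sum_univ_three]
  simp only [Fin.isValue, if_true, one_ne_zero, if_false, Fin.reduceEq]
  rw [C_mul_X_eq_monomial, C_mul_X_eq_monomial, X, Complex.ofReal_one]

/-- **Expansion of the site product** over configurations `κ : S → Fin 3`:
`∏_s (y + P_s u + Q_s t_s) = Σ_κ monomial(d_κ)(w_κ)` with `d_κ = Σ_s e(κ s, s)` and
`w_κ = ∏_s w_s(κ s)`. -/
theorem siteProduct_eq_sum_monomial (P Q : S → ℝ) :
    (∏ s, (X none + C (P s : ℂ) * X (some none) + C (Q s : ℂ) * X (some (some s))) :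
        MvPolynomial (Option (Option S)) ℂ) =
      ∑ κ : S → Fin 3, monomial
        (∑ s, (if κ s = 0 then Finsupp.single none 1 else if κ s = 1 then Finsupp.single (some none) 1
          else Finsupp.single (some (some s)) 1))
        (∏ s, (((if κ s = 1 then P s else if κ s = 2 then Q s else 1 : ℝ) : ℂ))) := by
  simp_rw [siteFactor_eq_sum P Q]
  rw [Fintype.prod_sum]
  refine Finset.sum_congr rfl fun κ _ => ?_
  rw [monomial_sum_prod]

omit [DecidableEq S] in
/-- The exponent vector of a configuration, regrouped by state. -/
theorem exponent_eq (κ : S → Fin 3) :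
    (∑ s, (if κ s = 0 then Finsupp.single none 1 else if κ s = 1 then Finsupp.single (some none) 1
        else Finsupp.single (some (some s)) 1) : Option (Option S) →₀ ℕ) =
      Finsupp.single none (univ.filter (fun s => κ s = 0)).card +
        Finsupp.single (some none) (univ.filter (fun s => κ s = 1)).card +
        ∑ s ∈ univ.filter (fun s => κ s = 2), Finsupp.single (some (some s)) 1 := by
  have hpt : ∀ s, (if κ s = 0 then Finsupp.single none 1 else if κ s = 1 then Finsupp.single (some none) 1
        else Finsupp.single (some (some s)) 1 : Option (Option S) →₀ ℕ) =
      (if κ s = 0 then Finsupp.single none 1 else 0) + (if κ s = 1 then Finsupp.single (some none) 1 else 0)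
        + (if κ s = 2 then Finsupp.single (some (some s)) 1 else 0) := by
    intro s
    obtain ⟨j, hj⟩ : ∃ j, κ s = j := ⟨_, rfl⟩
    rw [hj]
    fin_cases j <;> simp
  simp_rw [hpt]
  rw [Finset.sum_add_distrib, Finset.sum_add_distrib, ← Finset.sum_filter, ← Finset.sum_filter,
    ← Finset.sum_filter, Finset.sum_const, Finset.sum_const, Finsupp.smul_single, Finsupp.smul_single,
    smul_eq_mul, mul_one, smul_eq_mul, mul_one]

omit [Fintype S] in
/-- Values of the indicator exponent `Σ_{s ∈ Y₀} e_{t_s}`. -/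
theorem indicator_apply (Y₀ : Finset S) (v : Option (Option S)) :
    (∑ s ∈ Y₀, Finsupp.single (some (some s)) (1:ℕ)) v =
      match v with
      | some (some s) => if s ∈ Y₀ then 1 else 0
      | _ => 0 := by
  rw [Finsupp.finsetSum_apply]
  rcases v with _ | _ | s
  · simp
  · simp
  · simp only [Finsupp.single_apply, Option.some.injEq]
    rw [Finset.sum_ite_eq' Y₀ s (fun _ => 1)]


/-! ### The identification -/

/-- **Identification of the Y-head level polynomial**:
`[(∂_y^b ∂_u^A ∏_s (y + P_s u + Q_s t_s))|_{u=0}]|_{y=0} = A!·b!·Σ_{Y₀} ν(Y₀)·∏_{s ∈ Y₀} t_s`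
with `ν(Y₀) = Σ {w(κ) : κ⁻¹(2) = Y₀, #κ⁻¹(1) = A, #κ⁻¹(0) = b}`. -/
theorem siteLevel_identity (P Q : S → ℝ) (A b : ℕ) :
    bind₁ (Function.update X none (C (0:ℂ)))
        (bind₁ (Function.update X (some none) (C (0:ℂ)))
          ((pderiv none)^[b] ((pderiv (some none))^[A]
            (∏ s, (X none + C (P s : ℂ) * X (some none) + C (Q s : ℂ) * X (some (some s))) :
              MvPolynomial (Option (Option S)) ℂ)))) =
      C ((A.factorial : ℂ) * (b.factorial : ℂ)) *
        ∑ Y₀ : Finset S, C (((∑ κ ∈ univ.filter (fun κ : S → Fin 3 =>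
            univ.filter (fun s => κ s = 2) = Y₀ ∧ (univ.filter (fun s => κ s = 1)).card = A ∧
              (univ.filter (fun s => κ s = 0)).card = b),
            ∏ s, (if κ s = 1 then P s else if κ s = 2 then Q s else 1) : ℝ) : ℂ)) *
          ∏ s ∈ Y₀, X (some (some s)) := by
  rw [siteProduct_eq_sum_monomial, iterate_pderiv_sum, iterate_pderiv_sum, map_sum, map_sum]
  have hstep : ∀ κ : S → Fin 3,
      bind₁ (Function.update X none (C (0:ℂ)))
        (bind₁ (Function.update X (some none) (C (0:ℂ)))
          ((pderiv none)^[b] ((pderiv (some none))^[A] (monomial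
            (∑ s, (if κ s = 0 then Finsupp.single none 1 else if κ s = 1 then Finsupp.single (some none) 1
              else Finsupp.single (some (some s)) 1))
            (∏ s, (((if κ s = 1 then P s else if κ s = 2 then Q s else 1 : ℝ) : ℂ))))))) =
      if (univ.filter (fun s => κ s = 1)).card = A ∧ (univ.filter (fun s => κ s = 0)).card = b then
        monomial (∑ s ∈ univ.filter (fun s => κ s = 2), Finsupp.single (some (some s)) 1)
          ((∏ s, (((if κ s = 1 then P s else if κ s = 2 then Q s else 1 : ℝ) : ℂ))) *
            (A.factorial : ℂ) * (b.factorial : ℂ))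
      else 0 := by
    intro κ
    rw [extract_monomial (some none) none (by simp) A b, exponent_eq]
    have hu : (Finsupp.single none (univ.filter (fun s => κ s = 0)).card +
        Finsupp.single (some none) (univ.filter (fun s => κ s = 1)).card +
        ∑ s ∈ univ.filter (fun s => κ s = 2), Finsupp.single (some (some s)) 1 :
          Option (Option S) →₀ ℕ) (some none) = (univ.filter (fun s => κ s = 1)).card := by
      rw [Finsupp.add_apply, Finsupp.add_apply, indicator_apply, Finsupp.single_eq_same,
        Finsupp.single_eq_of_ne (by simp)]
      simp
    have hy : (Finsupp.single none (univ.filter (fun s => κ s = 0)).card +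
        Finsupp.single (some none) (univ.filter (fun s => κ s = 1)).card +
        ∑ s ∈ univ.filter (fun s => κ s = 2), Finsupp.single (some (some s)) 1 :
          Option (Option S) →₀ ℕ) none = (univ.filter (fun s => κ s = 0)).card := by
      rw [Finsupp.add_apply, Finsupp.add_apply, indicator_apply, Finsupp.single_eq_same,
        Finsupp.single_eq_of_ne (by simp)]
      simp
    rw [hu, hy]
    by_cases hc : (univ.filter (fun s => κ s = 1)).card = A ∧ (univ.filter (fun s => κ s = 0)).card = b
    · rw [if_pos hc, if_pos hc, ← hc.1, ← hc.2,
        add_right_comm (Finsupp.single none _) (Finsupp.single (some none) _),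
        add_tsub_cancel_right, add_tsub_cancel_left]
    · rw [if_neg hc, if_neg hc]
  simp_rw [hstep]
  rw [← Finset.sum_filter]
  -- right-hand side
  symm
  rw [Finset.mul_sum]
  have hmon : ∀ Y₀ : Finset S, (∏ s ∈ Y₀, X (some (some s)) : MvPolynomial (Option (Option S)) ℂ) =
      monomial (∑ s ∈ Y₀, Finsupp.single (some (some s)) 1) 1 := by
    intro Y₀
    rw [monomial_sum_one]
    rfl
  have hY : ∀ Y₀ : Finset S,
      C ((A.factorial : ℂ) * (b.factorial : ℂ)) *
        (C (((∑ κ ∈ univ.filter (fun κ : S → Fin 3 =>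
            univ.filter (fun s => κ s = 2) = Y₀ ∧ (univ.filter (fun s => κ s = 1)).card = A ∧
              (univ.filter (fun s => κ s = 0)).card = b),
            ∏ s, (if κ s = 1 then P s else if κ s = 2 then Q s else 1) : ℝ) : ℂ)) *
          ∏ s ∈ Y₀, X (some (some s))) =
      ∑ κ ∈ (univ.filter (fun κ : S → Fin 3 => (univ.filter (fun s => κ s = 1)).card = A ∧
              (univ.filter (fun s => κ s = 0)).card = b)).filter
            (fun κ => univ.filter (fun s => κ s = 2) = Y₀),
        monomial (∑ s ∈ univ.filter (fun s => κ s = 2), Finsupp.single (some (some s)) 1)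
          ((∏ s, (((if κ s = 1 then P s else if κ s = 2 then Q s else 1 : ℝ) : ℂ))) *
            (A.factorial : ℂ) * (b.factorial : ℂ)) := by
    intro Y₀
    rw [hmon, C_mul_monomial, C_mul_monomial, mul_one, Finset.filter_filter]
    push_cast
    rw [Finset.mul_sum, map_sum]
    refine Finset.sum_congr (Finset.filter_congr fun κ _ => by tauto) fun κ hκ => ?_
    have hκ' : univ.filter (fun s => κ s = 2) = Y₀ := ((Finset.mem_filter.1 hκ).2).2
    rw [hκ']
    congr 1
    ring
  simp_rw [hY]
  exact Finset.sum_fiberwise_of_maps_to (fun _ _ => Finset.mem_univ _) _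


omit [Fintype S] in
/-- The indicator exponent determines the set. -/
theorem indicator_injective {Y₁ Y₀ : Finset S}
    (h : (∑ s ∈ Y₁, Finsupp.single (some (some s)) (1:ℕ) : Option (Option S) →₀ ℕ) =
      ∑ s ∈ Y₀, Finsupp.single (some (some s)) 1) : Y₁ = Y₀ := by
  ext s
  have := congrArg (fun f : Option (Option S) →₀ ℕ => f (some (some s))) h
  simp only [indicator_apply] at this
  by_cases h1 : s ∈ Y₁ <;> by_cases h0 : s ∈ Y₀ <;> simp_all

/-- **The Y-site family is stable or zero** (Lemma SR of THEOREM MT in coefficient form).  For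
non-negative site weights `P, Q` and prescribed numbers `A` of `X`-sites and `b` of empty sites,
the real family `ν(Y₀) = Σ {w(κ) : κ⁻¹(2) = Y₀, #κ⁻¹(1) = A, #κ⁻¹(0) = b}` on `Finset S` is
identically zero, or its generating polynomial `Σ_{Y₀} ν(Y₀) z^{Y₀}` has no zero in the open upper
half-space. -/
theorem siteLevel_stableOrZero (P Q : S → ℝ) (hP : ∀ s, 0 ≤ P s) (hQ : ∀ s, 0 ≤ Q s) (A b : ℕ) :
    (∀ Y₀ : Finset S, (∑ κ ∈ univ.filter (fun κ : S → Fin 3 =>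
        univ.filter (fun s => κ s = 2) = Y₀ ∧ (univ.filter (fun s => κ s = 1)).card = A ∧
          (univ.filter (fun s => κ s = 0)).card = b),
        ∏ s, (if κ s = 1 then P s else if κ s = 2 then Q s else 1)) = 0) ∨
    ∀ z : S → ℂ, (∀ s, 0 < (z s).im) →
      (∑ Y₀ : Finset S, (((∑ κ ∈ univ.filter (fun κ : S → Fin 3 =>
          univ.filter (fun s => κ s = 2) = Y₀ ∧ (univ.filter (fun s => κ s = 1)).card = A ∧
            (univ.filter (fun s => κ s = 0)).card = b),
          ∏ s, (if κ s = 1 then P s else if κ s = 2 then Q s else 1)) : ℝ) : ℂ) *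
        ∏ s ∈ Y₀, z s) ≠ 0 := by
  have h := YHeadLevelStable.yHeadLevel_zero_or_stable P Q hP hQ A b
  rw [Complex.ofReal_zero, siteLevel_identity] at h
  have hmon : ∀ (Y₀ : Finset S) (r : ℝ),
      (C ((r : ℝ) : ℂ) * ∏ s ∈ Y₀, X (some (some s)) : MvPolynomial (Option (Option S)) ℂ) =
        monomial (∑ s ∈ Y₀, Finsupp.single (some (some s)) 1) ((r : ℝ) : ℂ) := by
    intro Y₀ r
    rw [show (∏ s ∈ Y₀, X (some (some s)) : MvPolynomial (Option (Option S)) ℂ) =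
        ∏ s ∈ Y₀, monomial (Finsupp.single (some (some s)) 1) 1 from rfl,
      ← monomial_sum_one, C_mul_monomial, mul_one]
  rcases h with h0 | hst
  · left
    have hAB : (C ((A.factorial : ℂ) * (b.factorial : ℂ)) : MvPolynomial (Option (Option S)) ℂ) ≠ 0 := by
      rw [Ne, C_eq_zero]
      exact mul_ne_zero (Nat.cast_ne_zero.2 (Nat.factorial_ne_zero A))
        (Nat.cast_ne_zero.2 (Nat.factorial_ne_zero b))
    have hsum := (mul_eq_zero.1 h0).resolve_left hAB
    intro Y₀
    have hc := congrArg (coeff (∑ s ∈ Y₀, Finsupp.single (some (some s)) (1:ℕ))) hsum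
    rw [coeff_sum, coeff_zero] at hc
    simp_rw [hmon, coeff_monomial] at hc
    rw [Finset.sum_eq_single Y₀ (fun Y₁ _ hne => if_neg fun h => hne (indicator_injective h))
      (fun h => absurd (Finset.mem_univ _) h), if_pos rfl] at hc
    exact_mod_cast hc
  · right
    intro z hz
    have hne := hst (fun v => Option.elim v Complex.I (fun w => Option.elim w Complex.I z)) (by
      rintro (_ | _ | s)
      · simp
      · simp
      · simpa using hz s)
    simp only [map_mul, eval_C, map_sum, map_prod, eval_X, Option.elim_some] at hne
    exact (mul_ne_zero_iff.1 hne).2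

omit [DecidableEq S] in
/-- Counting the sites by state: `#κ⁻¹(0) + #κ⁻¹(1) + #κ⁻¹(2) = |S|`. -/
theorem card_states (κ : S → Fin 3) :
    (univ.filter (fun s => κ s = 0)).card + (univ.filter (fun s => κ s = 1)).card +
      (univ.filter (fun s => κ s = 2)).card = Fintype.card S := by
  have h := Finset.card_eq_sum_card_fiberwise (f := κ) (s := (univ : Finset S))
    (t := (univ : Finset (Fin 3))) (fun _ _ => Finset.mem_univ _)
  rw [Fin.sum_univ_three] at h
  rw [← Finset.card_univ, h]

/-- **The Y-site family at quotas `(#X, #Y) = (A, C)` is stable or zero**: the same as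
`siteLevel_stableOrZero` with the constraint `#κ⁻¹(2) = C` in place of `#κ⁻¹(0) = b`. -/
theorem siteLevel_stableOrZero_XY (P Q : S → ℝ) (hP : ∀ s, 0 ≤ P s) (hQ : ∀ s, 0 ≤ Q s) (A C : ℕ) :
    (∀ Y₀ : Finset S, (∑ κ ∈ univ.filter (fun κ : S → Fin 3 =>
        univ.filter (fun s => κ s = 2) = Y₀ ∧ (univ.filter (fun s => κ s = 1)).card = A ∧
          (univ.filter (fun s => κ s = 2)).card = C),
        ∏ s, (if κ s = 1 then P s else if κ s = 2 then Q s else 1)) = 0) ∨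
    ∀ z : S → ℂ, (∀ s, 0 < (z s).im) →
      (∑ Y₀ : Finset S, (((∑ κ ∈ univ.filter (fun κ : S → Fin 3 =>
          univ.filter (fun s => κ s = 2) = Y₀ ∧ (univ.filter (fun s => κ s = 1)).card = A ∧
            (univ.filter (fun s => κ s = 2)).card = C),
          ∏ s, (if κ s = 1 then P s else if κ s = 2 then Q s else 1)) : ℝ) : ℂ) *
        ∏ s ∈ Y₀, z s) ≠ 0 := by
  by_cases hAC : A + C ≤ Fintype.card S
  · -- the two constraints define the same configurations, with b = |S| - A - C
    have hiff : ∀ κ : S → Fin 3, ∀ Y₀ : Finset S,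
        (univ.filter (fun s => κ s = 2) = Y₀ ∧ (univ.filter (fun s => κ s = 1)).card = A ∧
          (univ.filter (fun s => κ s = 2)).card = C) ↔
        (univ.filter (fun s => κ s = 2) = Y₀ ∧ (univ.filter (fun s => κ s = 1)).card = A ∧
          (univ.filter (fun s => κ s = 0)).card = Fintype.card S - A - C) := by
      intro κ Y₀
      have hk := card_states κ
      constructor
      · rintro ⟨h1, h2, h3⟩; exact ⟨h1, h2, by omega⟩
      · rintro ⟨h1, h2, h3⟩; exact ⟨h1, h2, by omega⟩
    have h := siteLevel_stableOrZero P Q hP hQ A (Fintype.card S - A - C)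
    simp_rw [← hiff] at h
    exact h
  · -- no configuration has these quotas: the family vanishes
    left
    intro Y₀
    refine Finset.sum_eq_zero fun κ hκ => ?_
    exfalso
    have hk := card_states κ
    have h := (Finset.mem_filter.1 hκ).2
    omega


end SiteLevelFamily

end Summit.CriticalPhenomena.PercolationContinuityZ3.Theorems
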